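import Mathlib
import HarnessLib
import Summits.NavierStokesRegularity.NavierStokesRegularity.Theorems.PoloidalWindowDoorPoloidalWindowRigidityZShockHeightEvolution
import Summits.NavierStokesRegularity.NavierStokesRegularity.Theorems.PoloidalWindowDoorPoloidalWindowRigidityZShockSliceTyping
import Summits.NavierStokesRegularity.NavierStokesRegularity.Theorems.PoloidalWindowDoorPoloidalWindowRigidityZShockConeValues
import Summits.NavierStokesRegularity.NavierStokesRegularity.Theorems.PoloidalWindowDoorPoloidalWindowRigidityZShockWaveLocalEnergyLocal

/-!
# Crux K2 `PoloidalWindowRigidity` (stmt-NavierStokesRegularity-19708), line `z_shock` — R3 ENTRANCE COMPOSED AT CLASS LEVEL: the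
# cone-local wave-energy inequality for the slice of a class profile on every solid cone inside a strictly hyperbolic non-degenerate region

`--supports stmt-NavierStokesRegularity-19708 --as helper` (leafhand-ns-poloidalwindowdoor-3 g6, cell decomp-ns, 2026-08-31).
**No stub and no summit is closed by this file; Navier–Stokes regularity is NOT proved here (rung 0).**

WHY THIS FILE.  It certifies, in the kernel, that the R3 infrastructure of hands 2-g0/3-g4/3-g5/3-g6 COMPOSES on the objects of the
deciding stub `stub_zShockThickAut`: class binders (Type-I rate, continuity, Oseen identity, divergence-free, poloidal) + the stub's LOCAL
autonomy clause at `z₀ ∈ W₁` (`∂_z v_b = g(t, v₂)·∂_b v₂` on `W₁`), an open preconnected non-degenerate region `Ω` of the slice at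
`t₀ = z₀.1`, a base point `c₀` and a truncated solid cone `{t₁ ≤ s ≤ t₂, ‖y‖ ≤ √(1+ρ²) + c(t₂ − s) + 1}` whose chart image
`pt c₀ 1 s y` lies in `Ω`, on which the window is STRICTLY HYPERBOLIC (`∂₂v₀∂₀v₂ + ∂₂v₁∂₁v₂ < 0`, stub vocabulary) with characteristic
speed at most `c` (`−(∂₂v₀∂₀v₂ + ∂₂v₁∂₁v₂) ≤ c²((∂₀v₂)² + (∂₁v₂)²)`) ⟹

`coneEnergy_of_class_autonomy`: there are a GLOBALLY SMOOTH slope function `G̃` (equal, on the cone, to the slope: `∂₂v_b = G̃(v₂)∂_b v₂`,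
`b = 0, 1`) and a constant `K ≥ 0` such that the slice field `W(s, y) = v₂(t₀, pt c₀ 1 s y)` obeys, for every height `t ∈ [t₁, t₂]`,
`∫_{|y| ≤ ρ} e(t) dy ≤ exp(K(t − t₁)) ∫_{|y| ≤ √(1+ρ²) + c(t − t₁) + 1} e(t₁) dy`, `e = ½(∂ₛW)² + ½γ(W)|∇W|²`, `γ = −G̃ > 0` on the cone.

Chain (all tree theorems): `…ZShockHeightEvolution.heightEvolution_of_class_autonomy` (one analytic-at-values `G`, slope law and height-evolution
on `Ω`) → `…ZShockConeValues.exists_smooth_slope_on_solidCone` (`G̃ ∈ C^∞`) → `…ZShockSliceTyping.slice_wave_pde_field` (divergence-form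
equation in `(s, y)`) → `…ZShockHeightEvolution.slope_neg_of_hyperbolic` + `…ZShockConeValues.exists_energy_constants_on_solidCone`
(`γ > 0`, `K`) → `…ZShockWaveLocalEnergyLocal.waveEnergy_closedBall_le_exp_mul_local`.  (Normalisation of the cone's size is the class scaling
`v ↦ λv(λ²·, λ·)`, tree `nsRescale`; two-sidedness is `…ZShockSliceTyping.slice_wave_pde_reflect`.)

HONEST: an `∃ K` local energy bound is bookkeeping — its value is that the pieces provably fit; R3 (two-sided eternal rigidity of the thick
autonomous height-evolution, XL, not in print) is untouched. [folklore]
-/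

noncomputable section

namespace Summit.NavierStokesRegularity.NavierStokesRegularity.Theorems.PoloidalWindowDoorPoloidalWindowRigidityZShockConeEnergy

-- the problem directory repeats the summit name (`NavierStokesRegularity/NavierStokesRegularity`)
set_option linter.dupNamespace false

open Set Function Metric MeasureTheory
open scoped ContDiff
open Literature.Analysis Literature.Analysis.FluidPDE
open Summit.NavierStokesRegularity.NavierStokesRegularity.Theorems.PoloidalWindowDoorPoloidalWindowRigidityHorizontalMean
open Summit.NavierStokesRegularity.NavierStokesRegularity.Theorems.PoloidalWindowDoorPoloidalWindowRigidityZShockHeightEvolution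
open Summit.NavierStokesRegularity.NavierStokesRegularity.Theorems.PoloidalWindowDoorPoloidalWindowRigidityZShockSliceTyping
open Summit.NavierStokesRegularity.NavierStokesRegularity.Theorems.PoloidalWindowDoorPoloidalWindowRigidityZShockConeValues
open Summit.NavierStokesRegularity.NavierStokesRegularity.Theorems.PoloidalWindowDoorPoloidalWindowRigidityZShockWaveLocalEnergy
open Summit.NavierStokesRegularity.NavierStokesRegularity.Theorems.PoloidalWindowDoorPoloidalWindowRigidityZShockWaveLocalEnergyLocal

/-- The sub-cone with top `t ≤ t₂` lies in the cone with top `t₂` (`c ≥ 0`). [folklore] -/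
theorem cone_mono {c t₁ t₂ t s ρ : ℝ} (hc : 0 ≤ c) (ht : t ≤ t₂) (hs : s ∈ Icc t₁ t) {y : EuclideanSpace ℝ (Fin 2)}
    (hy : ‖y‖ ≤ √(1 + ρ ^ 2) + c * (t - s) + 1) :
    s ∈ Icc t₁ t₂ ∧ ‖y‖ ≤ √(1 + ρ ^ 2) + c * (t₂ - s) + 1 :=
  ⟨⟨hs.1, hs.2.trans ht⟩, hy.trans (by nlinarith)⟩

/-- **R3 entrance composed at class level: the cone-local wave-energy inequality for the slice of a class profile.**  See the module
docstring for the reading; hypotheses = binders of `stub_zShockThickAut` (class + local autonomy at `z₀ ∈ W₁`) + an open preconnected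
non-degenerate region `Ω` of the slice at `t₀ = z₀.1` + a truncated solid cone charted into `Ω` on which the window is strictly hyperbolic
with characteristic speed `≤ c`. [folklore] -/
theorem coneEnergy_of_class_autonomy (C : ℝ) (v : ℝ → EuclideanSpace ℝ (Fin 3) → EuclideanSpace ℝ (Fin 3))
    (hrate : Literature.Analysis.FluidPDE.HasTypeITimeDecay C v)
    (hcont : ContinuousOn (Function.uncurry v) (Set.Iio (0 : ℝ) ×ˢ Set.univ))
    (hmild : ∀ s t : ℝ, s < t → t < 0 → ∀ x, v t x =
      Literature.Analysis.UnboundedOperators.heatExtension (v s) (t - s) x -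
        Literature.Analysis.FluidPDE.oseenDuhamel 1 s v v t x)
    (hdiv : ∀ t < 0, Literature.Analysis.FluidPDE.VectorCalculus.IsDivFree (v t))
    (hpol : ∀ s < 0, ∀ y, inner ℝ (Literature.Analysis.FluidPDE.curl (v s) y) (EuclideanSpace.single 2 1) = 0)
    {W₁ : Set (ℝ × EuclideanSpace ℝ (Fin 3))} (hW₁ : IsOpen W₁) (hW₁s : W₁ ⊆ Set.Iio (0 : ℝ) ×ˢ Set.univ)
    {z₀ : ℝ × EuclideanSpace ℝ (Fin 3)} (hz₀ : z₀ ∈ W₁) {g : ℝ → ℝ → ℝ}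
    (haut : ∀ z ∈ W₁, ∀ b : Fin 3, b ≠ 2 →
      fderiv ℝ (v z.1) z.2 (EuclideanSpace.single 2 1) b =
        g z.1 (v z.1 z.2 2) * fderiv ℝ (v z.1) z.2 (EuclideanSpace.single b 1) 2)
    {Ω : Set (EuclideanSpace ℝ (Fin 3))} (hΩ : IsPreconnected Ω) (hΩo : IsOpen Ω)
    (hΩnd : ∀ x ∈ Ω, fderiv ℝ (v z₀.1) x (EuclideanSpace.single 0 1) 2 ≠ 0 ∨
      fderiv ℝ (v z₀.1) x (EuclideanSpace.single 1 1) 2 ≠ 0)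
    (c₀ : EuclideanSpace ℝ (Fin 3)) {c t₁ t₂ : ℝ} (hc : 0 ≤ c) (ht₁₂ : t₁ ≤ t₂) (ρ : ℝ)
    (hcone : ∀ s ∈ Icc t₁ t₂, ∀ y : EuclideanSpace ℝ (Fin 2), ‖y‖ ≤ √(1 + ρ ^ 2) + c * (t₂ - s) + 1 → pt c₀ 1 s y ∈ Ω)
    (hhyp : ∀ s ∈ Icc t₁ t₂, ∀ y : EuclideanSpace ℝ (Fin 2), ‖y‖ ≤ √(1 + ρ ^ 2) + c * (t₂ - s) + 1 →
      fderiv ℝ (v z₀.1) (pt c₀ 1 s y) (EuclideanSpace.single 2 1) 0 * fderiv ℝ (v z₀.1) (pt c₀ 1 s y) (EuclideanSpace.single 0 1) 2 +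
        fderiv ℝ (v z₀.1) (pt c₀ 1 s y) (EuclideanSpace.single 2 1) 1 * fderiv ℝ (v z₀.1) (pt c₀ 1 s y) (EuclideanSpace.single 1 1) 2 < 0)
    (hspeed : ∀ s ∈ Icc t₁ t₂, ∀ y : EuclideanSpace ℝ (Fin 2), ‖y‖ ≤ √(1 + ρ ^ 2) + c * (t₂ - s) + 1 →
      -(fderiv ℝ (v z₀.1) (pt c₀ 1 s y) (EuclideanSpace.single 2 1) 0 * fderiv ℝ (v z₀.1) (pt c₀ 1 s y) (EuclideanSpace.single 0 1) 2 +
          fderiv ℝ (v z₀.1) (pt c₀ 1 s y) (EuclideanSpace.single 2 1) 1 * fderiv ℝ (v z₀.1) (pt c₀ 1 s y) (EuclideanSpace.single 1 1) 2) ≤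
        c ^ 2 * (fderiv ℝ (v z₀.1) (pt c₀ 1 s y) (EuclideanSpace.single 0 1) 2 ^ 2 +
          fderiv ℝ (v z₀.1) (pt c₀ 1 s y) (EuclideanSpace.single 1 1) 2 ^ 2)) :
    ∃ Gs : ℝ → ℝ, ContDiff ℝ ∞ Gs ∧
      (∀ s ∈ Icc t₁ t₂, ∀ y : EuclideanSpace ℝ (Fin 2), ‖y‖ ≤ √(1 + ρ ^ 2) + c * (t₂ - s) + 1 →
        (∀ b : Fin 3, b ≠ 2 → fderiv ℝ (v z₀.1) (pt c₀ 1 s y) (EuclideanSpace.single 2 1) b =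
          Gs (v z₀.1 (pt c₀ 1 s y) 2) * fderiv ℝ (v z₀.1) (pt c₀ 1 s y) (EuclideanSpace.single b 1) 2) ∧
        0 < -Gs (v z₀.1 (pt c₀ 1 s y) 2)) ∧
      ∃ K : ℝ, 0 ≤ K ∧ ∀ t ∈ Icc t₁ t₂,
        ∫ y in closedBall (0 : EuclideanSpace ℝ (Fin 2)) ρ,
            ((1 / 2) * deriv (fun s'' => v z₀.1 (pt c₀ 1 s'' y) 2) t ^ 2 +
              (1 / 2) * -Gs (v z₀.1 (pt c₀ 1 t y) 2) *
                ∑ i, fderiv ℝ (fun y' => v z₀.1 (pt c₀ 1 t y') 2) y (EuclideanSpace.single i 1) ^ 2) ≤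
          Real.exp (K * (t - t₁)) *
            ∫ y in closedBall (0 : EuclideanSpace ℝ (Fin 2)) (√(1 + ρ ^ 2) + c * (t - t₁) + 1),
              ((1 / 2) * deriv (fun s'' => v z₀.1 (pt c₀ 1 s'' y) 2) t₁ ^ 2 +
                (1 / 2) * -Gs (v z₀.1 (pt c₀ 1 t₁ y) 2) *
                  ∑ i, fderiv ℝ (fun y' => v z₀.1 (pt c₀ 1 t₁ y') 2) y (EuclideanSpace.single i 1) ^ 2) := by
  -- Step 0: the slice is entire real-analytic, hence smooth; the slice field `W` is jointly smooth
  have ht₀ : z₀.1 < 0 := (Set.mem_prod.1 (hW₁s hz₀)).1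
  have hbdd : ∀ δ : ℝ, 0 < δ → ∃ B : ℝ, ∀ t < -δ, ∀ y : EuclideanSpace ℝ (Fin 3), ‖v t y‖ ≤ B := by
    intro δ hδ
    refine ⟨|C| / Real.sqrt δ, fun t ht y => ?_⟩
    have hδt : δ ≤ -t := by linarith
    have hsq : Real.sqrt δ ≤ Real.sqrt (-t) := Real.sqrt_le_sqrt hδt
    have hsqpos : 0 < Real.sqrt δ := Real.sqrt_pos.2 hδ
    calc ‖v t y‖ ≤ C / Real.sqrt (-t) := hrate t (by linarith) y
      _ ≤ |C| / Real.sqrt (-t) := by gcongr; exact le_abs_self C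
      _ ≤ |C| / Real.sqrt δ := by gcongr
  have han : AnalyticOnNhd ℝ (v z₀.1) univ :=
    Literature.Analysis.NavierStokesZoomKit.LocalSineTubeDoorProfileAlignedWindowRigidityAncient.analyticOnNhd_slice
      hcont hbdd hmild ht₀
  have hvinf : ContDiff ℝ ∞ (v z₀.1) := han.contDiff
  have hv2 : ContDiff ℝ 2 (v z₀.1) := han.contDiff
  have hvd : Differentiable ℝ (v z₀.1) := hv2.differentiable (by norm_num)
  set W : ℝ → EuclideanSpace ℝ (Fin 2) → ℝ := fun s y => v z₀.1 (pt c₀ 1 s y) 2 with hWdef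
  have hW : ContDiff ℝ ∞ (uncurry W) := contDiff_slice_uncurry (contDiff_apply_two hvinf) c₀
  have hWc : Continuous (uncurry W) := hW.continuous
  -- Step 1: ONE analytic slope function on `Ω`, slope law and height-evolution there
  obtain ⟨G, hGA, hGslope, hGpde⟩ :=
    heightEvolution_of_class_autonomy C v hrate hcont hmild hdiv hpol hW₁ hW₁s hz₀ haut hΩ hΩo hΩnd
  -- Step 2: `G < 0` on the cone (strict hyperbolicity) and the speed bound `-G ≤ c²`
  have hGneg : ∀ s ∈ Icc t₁ t₂, ∀ y : EuclideanSpace ℝ (Fin 2), ‖y‖ ≤ √(1 + ρ ^ 2) + c * (t₂ - s) + 1 →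
      G (W s y) < 0 ∧ -G (W s y) ≤ c ^ 2 := by
    intro s hs y hy
    have hx := hcone s hs y hy
    have h0 := hGslope _ hx 0 (by decide)
    have h1 := hGslope _ hx 1 (by decide)
    obtain ⟨hneg, hD⟩ := slope_neg_of_hyperbolic h0 h1 (hhyp s hs y hy)
    refine ⟨hneg, ?_⟩
    have hsp := hspeed s hs y hy
    rw [h0, h1] at hsp
    have hsum : -(G (v z₀.1 (pt c₀ 1 s y) 2) * fderiv ℝ (v z₀.1) (pt c₀ 1 s y) (EuclideanSpace.single 0 1) 2 *
          fderiv ℝ (v z₀.1) (pt c₀ 1 s y) (EuclideanSpace.single 0 1) 2 +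
        G (v z₀.1 (pt c₀ 1 s y) 2) * fderiv ℝ (v z₀.1) (pt c₀ 1 s y) (EuclideanSpace.single 1 1) 2 *
          fderiv ℝ (v z₀.1) (pt c₀ 1 s y) (EuclideanSpace.single 1 1) 2) =
        -G (v z₀.1 (pt c₀ 1 s y) 2) * (fderiv ℝ (v z₀.1) (pt c₀ 1 s y) (EuclideanSpace.single 0 1) 2 ^ 2 +
          fderiv ℝ (v z₀.1) (pt c₀ 1 s y) (EuclideanSpace.single 1 1) 2 ^ 2) := by ring
    rw [hsum] at hsp
    exact le_of_mul_le_mul_right hsp hD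
  -- Step 3: the globally smooth slope function `G̃` agreeing with `G` (and `G'`) at all cone values
  obtain ⟨Gs, hGs, hGsW⟩ := exists_smooth_slope_on_solidCone hWc ht₁₂ ρ
    (fun s hs y hy => hGA _ (hcone s hs y hy))
  -- Step 4: the divergence-form equation on the cone, with `γ = -G̃`
  have hpde : ∀ s ∈ Icc t₁ t₂, ∀ y : EuclideanSpace ℝ (Fin 2), ‖y‖ ≤ √(1 + ρ ^ 2) + c * (t₂ - s) + 1 →
      deriv (fun s' => deriv (fun s'' => W s'' y) s') s =
        ∑ i, fderiv ℝ (fun y' => -Gs (W s y') * fderiv ℝ (W s) y' (EuclideanSpace.single i 1)) y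
          (EuclideanSpace.single i 1) := by
    intro s hs y hy
    have hx := hcone s hs y hy
    obtain ⟨hval, -, hder⟩ := hGsW s hs y hy
    have hP := hGpde _ hx
    rw [← hval] at hP
    exact slice_wave_pde_field hv2 hder hP
  -- Step 5: the cone-local constants `γ > 0`, `|γ'(W)Wₛ| ≤ Kγ(W)`
  have hγ : ContDiff ℝ ∞ (fun r => -Gs r) := hGs.neg
  have hWs : Continuous (uncurry fun s y => deriv (fun s'' => W s'' y) s) := (contDiff_uncurry_deriv hW).continuous
  have hpos : ∀ s ∈ Icc t₁ t₂, ∀ y : EuclideanSpace ℝ (Fin 2), ‖y‖ ≤ √(1 + ρ ^ 2) + c * (t₂ - s) + 1 →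
      0 < (fun r => -Gs r) (W s y) := by
    intro s hs y hy
    obtain ⟨hval, -, -⟩ := hGsW s hs y hy
    simp only [hval]
    linarith [(hGneg s hs y hy).1]
  obtain ⟨c', K, -, hK, hbounds⟩ := exists_energy_constants_on_solidCone hWc hWs hγ.continuous
    (hγ.continuous_deriv (by simp)) ht₁₂ ρ hpos
  -- Step 6: assemble
  refine ⟨Gs, hGs, fun s hs y hy => ?_, K, hK, fun t ht => ?_⟩
  · obtain ⟨hval, -, -⟩ := hGsW s hs y hy
    refine ⟨fun b hb => ?_, ?_⟩
    · rw [hGslope _ (hcone s hs y hy) b hb, ← hval]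
    · have := (hGneg s hs y hy).1
      rw [← hval] at this
      linarith
  · -- the energy inequality on the sub-cone with top `t`
    have hsub : ∀ s ∈ Icc t₁ t, ∀ y : EuclideanSpace ℝ (Fin 2), ‖y‖ ≤ √(1 + ρ ^ 2) + c * (t - s) + 1 →
        s ∈ Icc t₁ t₂ ∧ ‖y‖ ≤ √(1 + ρ ^ 2) + c * (t₂ - s) + 1 := fun s hs y hy => cone_mono hc ht.2 hs hy
    have key := waveEnergy_closedBall_le_exp_mul_local (w := W) (γ := fun r => -Gs r) hW hγ hc hK ht.1 ρ
      (fun s hs y hy => hpde s (hsub s hs y hy).1 y (hsub s hs y hy).2)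
      (fun s hs y hy => (hbounds s (hsub s hs y hy).1 y (hsub s hs y hy).2).1)
      (fun s hs y hy => by
        obtain ⟨hval, -, -⟩ := hGsW s (hsub s hs y hy).1 y (hsub s hs y hy).2
        simp only [hval]
        exact (hGneg s (hsub s hs y hy).1 y (hsub s hs y hy).2).2)
      (fun s hs y hy => (hbounds s (hsub s hs y hy).1 y (hsub s hs y hy).2).2.2)
    simpa only [hWdef] using key

end Summit.NavierStokesRegularity.NavierStokesRegularity.Theorems.PoloidalWindowDoorPoloidalWindowRigidityZShockConeEnergy

end
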